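import Summits.QuantumFields.BalabanUV.T4Continuum.Spine.NE1p.DressedSmallFieldComponentInnerNestedTori
import Summits.QuantumFields.BalabanUV.T4Continuum.Spine.NE1p.DressedSmallFieldNestedToriWitnessLive

/-!
# T⁴ programme, spine estimate NE1′ (node O3b/H2) — S51's FULLY SUPPLIED NESTED-TORI END FIRES: a DECIDED applier of
# `DressedSmallFieldComponentInnerNestedTori.attachedPart_locE_le_of_coresAt_pencil_components_inner_nestedTori` on W59's two-scale datum
# (the centre cube `C_L` of block 0 of the FINE torus `tsys 4 (L·N′)` under the coarse unit block `X₀ N′`) RE-LABELLED WITH N0u's ADMISSIBLE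
# LABEL `⟨∅, ({C_L}, ∅)⟩`, N0u's letters LOCATED (`δκ = 64·log 162 + 1`, `α₆ = α₆F`, `s = t = b₀ = 0`, `R_k = R₀N L`), EVERY clause met
# (five with equality), bound `K₀(64,8)`, LIVE — for every `3 ≤ L` and every `N′`; [Balaban1988RGII] pp. 17–20 KIND

Cell `pub-balaban`, sub-cell `t4`, BINDER-OWNERS row NE1′ (owner lineage t4-ne1p-p1, road P1); crew seat `b2b-balaban-t4-ne1p-formalise-leaf-01`
(LEAF PROVER 01, generation 14); crew W-row W69 ∕ DAG N29zzzw «S51 FIRES» (INTENT + PROTOTYPE + STAGED `CLAIMS.log` 2026-08-20 l.22189,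
BOOKED typer R-T138 l.22332; X199 its read; a (t5)-type non-vacuity witness of this lineage's S51).  ADDITIVE — imports this lineage's S51 `Spine/NE1p/DressedSmallFieldComponentInnerNestedTori`
and crew leaf-10's W59 PART 2 `Spine/NE1p/DressedSmallFieldNestedToriWitnessLive` (→ W59 PART 1 → the W24–W53 toy lineage + S44) ONLY; toy DATA `def`s (`εI`, `innerI`, `coveredI`, `uncoveredI`, `termsI`, `majI`, `cI`, `GI`,
`actI`) + one `abbrev` (`LabelI`) + theorems; 0 `def … : Prop`, 0 cite; W59's datum (`cL`, `CL`, `tclosureDom_CL`, `torusTreeLen_CL`), its located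
numerals (`rN`, `RN`, `vN`, `R₀N`, `εN`) and clause equalities (`hκ_N_eq`, `hRR_N_eq`, `hrate2_N_eq`, `hκR_N`, `hsmall_N`, `h229_N_eq`), W33's
cores (`coreW`, `ctr0`, `hroom0`), W35∕W41's letters (`letterMass_coreW`, `budget_half`, `termAt_coreW_pencil`, `closedForm_real_sub_zero`,
`norm_term_le`), W45's `α₆F` and W24's `X₀`∕`hrate_torus_num`∕`exp_locE_cube` are used BY NAME — nothing restated.

WHY THIS FILE.  S51 is a FACE with a long hypothesis list ((B1b) `hadm` in N0u's WRITTEN-OUT label form, N0u's table ∕ bonds letters,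
the composed (2.29) clause at `c₀ := 64·u_k − 5R_k`, the rate bookkeeping with the transfer factor `L∕a236 L`, (B3-amp) `hAmp` with N0u's
majorant); a referee asks of every END shape whether it is JOINTLY SATISFIABLE non-trivially ((t5)).  W59 answered that for S44 (inner
currency CHOSEN); this file answers it for S51 (inner currency N0u's): the SAME two-scale datum carries N0u's admissible label
`⟨W, (𝐃, P)⟩ = ⟨∅, ({C_L}, ∅)⟩`, N0u's letters are located so that the uncovered-cube letter `u_k = e^{5R_k}·s·e^{b₀t}` VANISHES (`s = 0`)
and the composed clause is S44's with equality once the inner count's `e^{−5R_k}` is refunded into `ε` (`εI := εN·e^{5R_k}` — S41.2's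
«the member's e^{−5R} is PAID by the inner count's e^{−5R_k}» read backwards); the covered label weighs `εN·α₆F` (W59: `εN`), the
uncovered one `v`; `R_k := R₀N L = 64·log 162 + (rN + RN)·a236 L∕L` is W59's inner rate WITH pv22's transfer term, so `hrate2` holds with
equality BY CONSTRUCTION (leaf-10-g11's remark, `CLAIMS.log` l.22261).  §1 letters + clauses (`h229k_I`∕`hκk_I`∕`hκR_I`∕`hrate2_I`∕`h229_I`); §2 datum + **`hadm_I`**; §3 majorant `majI`
(LITERALLY S51's `hAmp` shape) + cores `GI` + activity `actI` + **`hAmp_I`**; §4 **`componentInnerNestedToriEnd_fires`** (S51's single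
END ONCE BY NAME — NO closure ∕ anchor ∕ transfer ∕ link ∕ inner-count ∕ selector argument is passed: S51 has none) + closed form
`≤ K₀(64,8)`; §5 LIVE (`actI_X₀`, `actI_live`, `norm_actI_X₀_lt_one`, **`componentInnerNestedToriEnd_live`**, closing decided `example`
«liveness ∧ bound at L = 3 on every N′»).
WHAT STAYS DISPLAYED ∕ HONEST FRAMING.  A DECIDED TOY over hypothesis SHAPES: the cores are W33's one-dimensional Gaussian cores, NOT
Bałaban's (2.14) densities; (B1b) is MET BY CONSTRUCTION on the toy, NOT claimed for Bałaban's expansion; (B3-amp) `hAmp` is met BY CHOICE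
of the Cauchy weights — UNPRINTED for Bałaban's cores (G-ne9p2-5); the located numerals are pv22's ∕ the crew's PROVED constants; print's
½L, (L+2)⁴, (2.32)'s 4, «L > 11 odd» are TYPE∕CONTEXT only; no numeral of [Balaban1988RGII] is used.  0 binders instantiated on Bałaban's
densities; no wall item; wall v1.8 (T4-DAG v48) — words, not kind — does NOT move; R-t4r2-Q2 NOT met; NE1′ ⇐ the named binders — ONE
label NEW ∕ NOT PRINTED ∕ NOT PROVED; spine PROVED 0∕9; count 9 unchanged.  ABSOLUTE RULE honoured (nothing internally minted is cited;
[folklore]∕[arith] tags on kernel facts only).  Rung (B)+1 on ONE finite four-torus — NOT infinite volume, NOT a mass gap, NOT OS on ℝ⁴,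
NOT Clay.  HONEST DEPENDENCY: continuum YM on T⁴ ⇐ BetaPertH ∧ nine spine estimates (0/9 proved); BetaPertH ⇐ (D1) ∧ (D4) ∧ CAP+tail;
G-an2-4 gates asym, D1 and NE2/3/4.
-/

noncomputable section

namespace Summit.QuantumFields.BalabanUV.T4Continuum.NE1p.DressedSmallFieldComponentInnerNestedToriWitness

open Set Metric MeasureTheory Complex
open scoped BigOperators
open Literature.MathematicalPhysics.QuantumFieldTheory.Balaban1983to89
open Literature.MathematicalPhysics.QuantumFieldTheory.Balaban1983to89.B12TreeDecay (K₀ K₀_pos)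
open Literature.MathematicalPhysics.QuantumFieldTheory.Balaban1983to89.B13Resummation (locE)
open Literature.MathematicalPhysics.QuantumFieldTheory.Balaban1983to89.B13FamilySum (coveringFamilies mem_coveringFamilies)
open Literature.MathematicalPhysics.QuantumFieldTheory.Balaban1983to89.B13Geometry236 (a236 a236_pos)
open Literature.MathematicalPhysics.QuantumFieldTheory.Balaban1983to89.TreeLengthTorus (TPt TDom tsys torusTreeLen)
open Literature.MathematicalPhysics.QuantumFieldTheory.Balaban1983to89.TreeLengthTorusGeometry (tgeometry TTouch)
open Literature.MathematicalPhysics.QuantumFieldTheory.Balaban1983to89.TreeLengthTorusTransfer (tclosureDom)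
open Summit.QuantumFields.BalabanUV.T4Continuum.B13HistMeasurable (B13HistM)
open Summit.QuantumFields.BalabanUV.T4Continuum.B13HistWitness (toyFrame)
open Summit.QuantumFields.BalabanUV.T4Continuum.B13TermParamGaussianBi (BiCore)
open Summit.QuantumFields.BalabanUV.T4Continuum.NE1p.DressedSmallFieldTorusWitness (X₀ X₀_val hrate_torus_num dressedConst_le_one
  exp_locE_cube)
open Summit.QuantumFields.BalabanUV.T4Continuum.NE1p.DressedSmallFieldCoresWitness (E1 crd liveTable norm_liveTable_le coreW N₁_coreW ctr0
  hroom0 Acst Acst_pos incr integral_incr_pos)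
open Summit.QuantumFields.BalabanUV.T4Continuum.NE1p.DressedSmallFieldCoresMassWitness (letterMass_coreW cM cM_pos)
open Summit.QuantumFields.BalabanUV.T4Continuum.NE1p.DressedSmallFieldDepCoresWitness (budget_half termAt_coreW_pencil
  closedForm_real_sub_zero norm_term_le)
open Summit.QuantumFields.BalabanUV.T4Continuum.NE1p.DressedSmallFieldFamiliesWitness (α₆F α₆F_pos α₆F_le_one)
open Summit.QuantumFields.BalabanUV.T4Continuum.NE1p.DressedSmallFieldInnerLabelsWitness (coveringFamilies_emptyFootprint)
open Summit.QuantumFields.BalabanUV.T4Continuum.NE1p.DressedSmallFieldNestedToriWitness (cL CL tclosureDom_CL torusTreeLen_CL rN RN vN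
  R₀N εN vN_pos εN_pos hκ_N_eq hRR_N_eq hrate2_N_eq hκR_N hsmall_N εN_le_one vN_le)
open Summit.QuantumFields.BalabanUV.T4Continuum.NE1p.DressedSmallFieldComponentInnerNestedTori
  (attachedPart_locE_le_of_coresAt_pencil_components_inner_nestedTori)

variable (L N' : ℕ) [NeZero L] [NeZero N']

/-! ## §1 N0u's letters LOCATED at the fine torus: `δκ = 64·log 162 + 1` (= `rN`), `α₆ = α₆F`, `s = t = b₀ = 0`, `R_k = R₀N L`,
`bondsOf = ∅`; the amplitude `εI := εN·e^{5R_k}` so that the composed (2.29) clause is S44's WITH EQUALITY -/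

/-- THE COMPONENT AMPLITUDE (toy numeral): `εI := εN L · e^{5·R₀N L}` — the inner count's `e^{−5R_k}` (S41.2: «the member's e^{−5R} is PAID
by the inner count's e^{−5R_k}») is refunded into `ε`, so that `εI·e^{64·u_k − 5R_k} = εN L` at `u_k = 0`. [folklore] -/
def εI : ℝ := εN L * Real.exp (5 * R₀N L)

/-- `0 < εI`. [arith] -/ theorem εI_pos : 0 < εI L := mul_pos (εN_pos L) (Real.exp_pos _)
omit [NeZero L] in /-- `u_k = e^{5R_k}·0·e^{0·0} = 0`: N0u's uncovered-cube letter VANISHES at `s = 0`. [arith] -/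
theorem uk_zero : Real.exp (R₀N L * 5) * (0 : ℝ) * Real.exp ((0 : ℝ) * 0) = 0 := by rw [mul_zero, zero_mul]
/-- **S51's `h229k` WITH EQUALITY** (N0u's «α₆ sufficiently small» at the fine torus): `e·K₀(64,8)·64·α₆F = 1`. [arith] -/
theorem h229k_I : Real.exp 1 * K₀ 64 8 * 64 * α₆F ≤ 1 := by
  unfold α₆F
  have hK := K₀_pos (64 : ℝ) 8
  have he := Real.exp_pos 1
  rw [mul_inv_cancel₀ (by positivity)]

/-- **S51's `hκk` WITH EQUALITY** at `δ = 1`, `κ = rN`. [arith] -/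
theorem hκk_I : 64 * Real.log 162 + 1 ≤ (1 : ℝ) * rN := by rw [one_mul]; exact hκ_N_eq.le
omit [NeZero L] in /-- **S51's `hκR`** at `s = 0`: `64·log 162 ≤ R_k − 64·0 = R₀N L` (W59 `hκR_N`). [arith] -/
theorem hκR_I (hL : 3 ≤ L) :
    64 * Real.log 162 ≤ R₀N L - 64 * (Real.exp (R₀N L * 5) * (0 : ℝ) * Real.exp ((0 : ℝ) * 0)) := by
  rw [uk_zero, mul_zero, sub_zero]; exact hκR_N L hL

omit [NeZero L] in /-- **S51's `hrate2` WITH EQUALITY** at `s = 0` (W59 `hrate2_N_eq`: `r + R = (R₀ − 64 log 162)·(L∕a236 L)`). [arith] -/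
theorem hrate2_I (hL : 3 ≤ L) : rN + RN ≤
    (R₀N L - 64 * (Real.exp (R₀N L * 5) * (0 : ℝ) * Real.exp ((0 : ℝ) * 0)) - 64 * Real.log 162) * ((L : ℝ) / a236 L) := by
  rw [uk_zero, mul_zero, sub_zero]; exact (hrate2_N_eq L hL).le

/-- **S51's composed (2.29) clause `h229` WITH EQUALITY**: `e·K₀·64·(εI·e^{64·0 − 5R_k}·3⁴L⁴·K₀·e^{5R}) = e·K₀·64·(εN·e⁰·3⁴L⁴·K₀·e^{5R}) = 1`
(W59 `h229_N_eq`). [arith] -/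
theorem h229_I : Real.exp 1 * K₀ 64 8 * 64 *
    (εI L * Real.exp (64 * (Real.exp (R₀N L * 5) * (0 : ℝ) * Real.exp ((0 : ℝ) * 0)) - 5 * R₀N L) * ((3 : ℝ) ^ 4 * (L : ℝ) ^ 4) *
      K₀ 64 8 * Real.exp (5 * RN)) ≤ 1 := by
  have h : εI L * Real.exp (64 * (Real.exp (R₀N L * 5) * (0 : ℝ) * Real.exp ((0 : ℝ) * 0)) - 5 * R₀N L) = εN L * Real.exp 0 := by
    rw [uk_zero, mul_zero, zero_sub, Real.exp_zero, mul_one]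
    unfold εI
    rw [mul_assoc, ← Real.exp_add, show 5 * R₀N L + -(5 * R₀N L) = 0 by ring, Real.exp_zero, mul_one]
  rw [h]
  exact (DressedSmallFieldNestedToriWitness.h229_N_eq L).le

/-! ## §2 THE DATUM: W59's fine component `C_L` carrying N0u's ADMISSIBLE label `⟨∅, ({C_L}, ∅)⟩` (nothing uncovered, the one family `{C_L}`
covering its single cube, no bonds), under the coarse unit block `X₀ N′` -/

/-- S51's outer-label type with N0u's inner labels at the fine torus (a type abbreviation, no data; bonds `Unit`). [folklore] -/
abbrev LabelI : Type :=
  Σ _ : Finset (TPt 4 N'), Σ F : Finset (TDom 4 N'), ∀ Z ∈ F,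
    (Σ _ : TDom 4 (L * N'), (Σ _ : Finset (TPt 4 (L * N')), Finset (TDom 4 (L * N')) × Finset Unit))

/-- N0u's ADMISSIBLE INNER LABEL OF THE COMPONENT (toy DATA): `⟨W, (𝐃, P)⟩ := ⟨∅, ({C_L}, ∅)⟩`. [folklore] -/
def innerI : (Σ _ : Finset (TPt 4 (L * N')), Finset (TDom 4 (L * N')) × Finset Unit) := ⟨∅, ({CL L N'}, ∅)⟩

/-- THE COVERED LABEL (toy DATA): nothing uncovered, the ONE family `{X₀}`, for its member the component `C_L` with its inner label. [folklore] -/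
def coveredI : LabelI L N' := ⟨∅, ⟨{X₀ N'}, fun _ _ => ⟨CL L N', innerI L N'⟩⟩⟩
/-- THE UNCOVERED LABEL (toy DATA): the whole block uncovered, the empty family. [folklore] -/
def uncoveredI : LabelI L N' := ⟨{0}, ⟨∅, fun Z h => absurd h (Finset.notMem_empty Z)⟩⟩
/-- The two labels differ. [folklore] -/
theorem coveredI_ne_uncoveredI : coveredI L N' ≠ uncoveredI L N' := fun h =>
  (Finset.singleton_ne_empty (0 : TPt 4 N')).symm (congrArg Sigma.fst h)

open Classical in
/-- THE TERM INDEX OF RECORD (toy DATA): at the coarse unit block the two labels, nothing elsewhere. [folklore] -/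
def termsI (Z : TDom 4 N') : Finset (LabelI L N') := if Z = X₀ N' then {coveredI L N', uncoveredI L N'} else ∅

open Classical in
/-- The index at `X₀`. [folklore] -/ theorem termsI_X₀ : termsI L N' (X₀ N') = {coveredI L N', uncoveredI L N'} := if_pos rfl

open Classical in
/-- **S51's `hadm` MET** — the (B1b) READING clause in N0u's WRITTEN-OUT form: the component `C_L` lies in the closure fibre of `X₀`
(`tclosureDom_CL`), `W = ∅ ⊆ C_L`, the family `{C_L}` covers `C_L ∖ ∅` exactly, `P = ∅ ⊆ bondsOf ∅ = ∅` with `#W = 0 ≤ 2·#P`. [folklore] -/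
theorem hadm_I (hL : 3 ≤ L) : ∀ Z : (tsys 4 N').Dom, ∀ l ∈ termsI L N' Z, l.1 ⊆ Z.1 ∧
    l.2.1 ∈ coveringFamilies Finset.univ (fun Y : (tsys 4 N').Dom => Y.1) (Z.1 \ l.1) ∧
    ∀ Z' (h : Z' ∈ l.2.1), l.2.2 Z' h ∈
      ((Finset.univ : Finset (tsys 4 (L * N')).Dom).filter (fun Z₀ => tclosureDom L N' Z₀ = Z')).sigma fun Z₀ =>
        Z₀.1.powerset.sigma fun W =>
          coveringFamilies Finset.univ (fun Y : (tsys 4 (L * N')).Dom => Y.1) (Z₀.1 \ W) ×ˢ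
            ((fun _ : Finset (TPt 4 (L * N')) => (∅ : Finset Unit)) W).powerset.filter fun P => W.card ≤ 2 * P.card := by
  intro Z l hl
  unfold termsI at hl
  split_ifs at hl with hZ
  · subst hZ
    rcases Finset.mem_insert.1 hl with rfl | hl'
    · refine ⟨Finset.empty_subset _, ?_, fun Z' h => ?_⟩
      · show ({X₀ N'} : Finset (TDom 4 N')) ∈ coveringFamilies Finset.univ (tgeometry 4 N').cubes ((X₀ N').1 \ ∅)
        rw [Finset.sdiff_empty]
        exact mem_coveringFamilies.2 ⟨Finset.subset_univ _, Finset.singleton_biUnion⟩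
      · have hZ' : Z' = X₀ N' := Finset.mem_singleton.1 h
        subst hZ'
        refine Finset.mem_sigma.2 ⟨Finset.mem_filter.2 ⟨Finset.mem_univ _, tclosureDom_CL L N' hL⟩, ?_⟩
        refine Finset.mem_sigma.2 ⟨Finset.empty_mem_powerset _, Finset.mem_product.2 ⟨?_, ?_⟩⟩
        · show ({CL L N'} : Finset (TDom 4 (L * N'))) ∈
            coveringFamilies Finset.univ (tgeometry 4 (L * N')).cubes ((CL L N').1 \ ∅)
          rw [Finset.sdiff_empty]
          exact mem_coveringFamilies.2 ⟨Finset.subset_univ _, Finset.singleton_biUnion⟩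
        · exact Finset.mem_filter.2 ⟨Finset.empty_mem_powerset _, by
            show (∅ : Finset (TPt 4 (L * N'))).card ≤ 2 * (∅ : Finset Unit).card; simp⟩
    · rw [Finset.mem_singleton] at hl'
      subst hl'
      refine ⟨subset_rfl, ?_, fun Z' h => absurd h (Finset.notMem_empty Z')⟩
      show (∅ : Finset (TDom 4 N')) ∈ coveringFamilies Finset.univ (tgeometry 4 N').cubes ((X₀ N').1 \ {0})
      rw [X₀_val, Finset.sdiff_self, coveringFamilies_emptyFootprint (tgeometry 4 N')]; exact Finset.mem_singleton_self _
  · exact absurd hl (Finset.notMem_empty l)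

/-! ## §3 THE CORES: S51's table-blind majorant in N0u's currency, W33's one-label core at that weight -/

/-- S51's majorant of a label (toy DATA) — LITERALLY the shape in S51's `hAmp` at the located letters:
`v^{#W′}·Π_{x∈F.attach} εI·((Π_{Y∈𝐃(x)} α₆F·e^{−(1·rN)·d_k Y}·e^{−R_k(d_k Y + 5)})·(0²·0)^{#P(x)})`. [folklore] -/
def majI (l : LabelI L N') : ℝ :=
  vN ^ l.1.card * ∏ x ∈ l.2.1.attach, (εI L *
    ((∏ Y ∈ (l.2.2 x.1 x.2).2.2.1,
        (α₆F * Real.exp (-((1 : ℝ) * rN * torusTreeLen Y.1)) * Real.exp (-(R₀N L * (torusTreeLen Y.1 + 5))))) *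
      ((0 : ℝ) ^ 2 * 0) ^ (l.2.2 x.1 x.2).2.2.2.card))
/-- `0 ≤ maj`. [arith] -/ theorem majI_nonneg (l : LabelI L N') : 0 ≤ majI L N' l :=
  mul_nonneg (pow_nonneg vN_pos.le _) (Finset.prod_nonneg fun _ _ => mul_nonneg (εI_pos L).le
    (mul_nonneg (Finset.prod_nonneg fun _ _ => by have := α₆F_pos; positivity) (pow_nonneg (by norm_num) _)))
/-- **THE COVERED LABEL WEIGHS `εN·α₆F`**: one member, one family member `C_L` of tree length `0` at weight `α₆F·e^{−5R_k}`, no bonds;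
`εI·α₆F·e^{−5R_k} = εN·α₆F`. [arith] -/
theorem majI_coveredI : majI L N' (coveredI L N') = εN L * α₆F := by
  unfold majI coveredI innerI
  rw [Finset.card_empty, pow_zero, one_mul, Finset.prod_attach {X₀ N'} (fun _ => εI L *
    ((∏ Y ∈ ({CL L N'} : Finset (TDom 4 (L * N'))),
        (α₆F * Real.exp (-((1 : ℝ) * rN * torusTreeLen Y.1)) * Real.exp (-(R₀N L * (torusTreeLen Y.1 + 5))))) *
      ((0 : ℝ) ^ 2 * 0) ^ (∅ : Finset Unit).card)),
    Finset.prod_singleton, Finset.prod_singleton, torusTreeLen_CL, Finset.card_empty, pow_zero, mul_one, mul_zero, neg_zero,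
    Real.exp_zero, mul_one, zero_add]
  unfold εI
  rw [show εN L * Real.exp (5 * R₀N L) * (α₆F * Real.exp (-(R₀N L * 5))) =
    εN L * α₆F * (Real.exp (5 * R₀N L) * Real.exp (-(R₀N L * 5))) by ring, ← Real.exp_add,
    show 5 * R₀N L + -(R₀N L * 5) = 0 by ring, Real.exp_zero, mul_one]
/-- **THE UNCOVERED LABEL WEIGHS `v`**. [arith] -/
theorem majI_uncoveredI : majI L N' (uncoveredI L N') = vN := by
  unfold majI uncoveredI
  rw [Finset.card_singleton, pow_one, Finset.attach_empty, Finset.prod_empty, mul_one]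

open Classical in
/-- **THE MAJORANT MASS OF THE COARSE UNIT BLOCK**: `Σ_l maj l = εN·α₆F + v`. [folklore] -/
theorem majI_sum_X₀ : ∑ l ∈ termsI L N' (X₀ N'), majI L N' l = εN L * α₆F + vN := by
  rw [termsI_X₀, Finset.sum_insert (by rw [Finset.mem_singleton]; exact coveredI_ne_uncoveredI L N'), Finset.sum_singleton,
    majI_coveredI, majI_uncoveredI]

/-- `εN·α₆F + v ≤ 1 + 1∕64` (`εN ≤ 1`, `α₆F ≤ 1`, `v ≤ 1∕64`). [arith] -/
theorem mass_le : εN L * α₆F + vN ≤ 1 + 1 / 64 := by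
  have h1 : εN L * α₆F ≤ 1 := by
    calc εN L * α₆F ≤ 1 * 1 := mul_le_mul (εN_le_one L) α₆F_le_one α₆F_pos.le zero_le_one
      _ = 1 := one_mul 1
  linarith [vN_le]

variable (r : ℝ) (hr : 0 ≤ r)

/-- THE LABEL-DEPENDENT CAUCHY WEIGHT (toy DATA): `c l := (cM r∕2)·maj l`. [folklore] -/
def cI (l : LabelI L N') : ℝ := cM r / 2 * majI L N' l

/-- **THE LABEL-INDEXED CORE FAMILY** (toy DATA): W33's one-label core `coreW` at the weight `c l`. [folklore] -/
def GI : ∀ (_ : ℕ) (_ : LabelI L N'), ℕ → BiCore toyFrame (fun _ : Unit => (0 : ℕ)) ℂ Unit E1 :=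
  fun _ l _ => coreW (cI L N' r l) r hr
/-- The core at `(k, l, X)`. [folklore] -/ @[simp] theorem GI_apply (k : ℕ) (l : LabelI L N') (X : ℕ) : GI L N' r hr k l X = coreW (cI L N' r l) r hr := rfl

/-- THE ACTIVITY OF RECORD (toy DATA): the sum over the index of the cores' terms along the pencil `s ↦ 0 + s • liveTable`. [folklore] -/
def actI (k : ℕ) (s : ℂ) (Z : (tsys 4 N').Dom) : ℂ :=
  ∑ l ∈ termsI L N' Z, (GI L N' r hr k l k).termAt (0 : ℂ) ((0 : B13HistM toyFrame) + s • liveTable)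

/-- **S51's `hAmp` MET FOR EVERY SUB-POLYMER AND EVERY LABEL** [decided toy], in the LITERAL binder shape of S51 at NE5's toy letters
`(1, 0, 1)`, `ϱ = 2`, `A₀ = 0`, `A₁ = A∕4`: `maj l·|cM r∕2|·√(2π)·e^{r·2‖liveTable‖} ≤ (0 + 2·(A∕4))·maj l` (W35, W41 BY NAME). [folklore] -/
theorem hAmp_I (k : ℕ) :
    ∀ Z : (tsys 4 N').Dom, Z.1 ⊆ (X₀ N').1 → ∀ l ∈ termsI L N' Z,
      (GI L N' r hr k l k).lam.real univ *
          ((GI L N' r hr k l k).wB * (fun (_ : ℕ) (_ : LabelI L N') (_ : ℕ) => (1 : ℝ)) k l k *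
            Real.exp ((fun (_ : ℕ) (_ : LabelI L N') (_ : ℕ) => (0 : ℝ)) k l k)) *
          (Real.pi / ((fun (_ : ℕ) (_ : LabelI L N') (_ : ℕ) => (1 : ℝ)) k l k / 2)) ^ (Module.finrank ℝ E1 / 2 : ℝ) *
        Real.exp ((GI L N' r hr k l k).N₁ * (‖(0 : B13HistM toyFrame)‖ + 2 * ‖liveTable‖)) ≤
      (0 + 2 * (Acst / 4)) * (vN ^ l.1.card * ∏ x ∈ l.2.1.attach, (εI L *
        ((∏ Y ∈ (l.2.2 x.1 x.2).2.2.1,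
            (α₆F * Real.exp (-((1 : ℝ) * rN * torusTreeLen Y.1)) * Real.exp (-(R₀N L * (torusTreeLen Y.1 + 5))))) *
          ((0 : ℝ) ^ 2 * 0) ^ (l.2.2 x.1 x.2).2.2.2.card))) := by
  intro Z _ l _
  simp only [GI_apply]
  rw [letterMass_coreW, N₁_coreW, norm_zero, zero_add]
  have hp : 0 ≤ majI L N' l := majI_nonneg L N' l
  have hT : 2 * ‖liveTable‖ ≤ 2 := by linarith [norm_liveTable_le]
  have hb := budget_half r hr hT
  show |cI L N' r l| * Real.sqrt (2 * Real.pi) * Real.exp (r * (2 * ‖liveTable‖)) ≤ (0 + 2 * (Acst / 4)) * majI L N' l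
  unfold cI
  rw [abs_mul, abs_of_nonneg hp]
  calc |cM r / 2| * majI L N' l * Real.sqrt (2 * Real.pi) * Real.exp (r * (2 * ‖liveTable‖))
      = majI L N' l * (|cM r / 2| * Real.sqrt (2 * Real.pi) * Real.exp (r * (2 * ‖liveTable‖))) := by ring
    _ ≤ majI L N' l * (Acst / 2) := mul_le_mul_of_nonneg_left hb hp
    _ = (0 + 2 * (Acst / 4)) * majI L N' l := by ring

/-! ## §4 S51's END FIRES: the fully supplied nested-tori END applied ONCE BY NAME, for every `3 ≤ L` and every `N′` -/

open Classical in
/-- **S51's `attachedPart_locE_le_of_coresAt_pencil_components_inner_nestedTori` FIRES** [decided toy]: the coarse torus `tsys 4 N′`, the FINE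
torus `tsys 4 (L·N′)`, the cores `GI` indexed by the two labels, W33's `ctr0`∕`hroom0`, NE5's toy letters INLINE, the pencil's two radius
inequalities, `hscale`∕`hact` by `rfl`, W24's `hrate_torus_num`, W59's `hsmall_N`; N0u's letters `bondsOf := ∅`, `(δ, κ, α₆, R_k, b₀, s, t) :=
(1, rN, α₆F, R₀N L, 0, 0, 0)` with §1's clauses; `(ε, r, R, v) := (εI, rN, RN, vN)` with §1's `h229_I` and W59's `hRR_N_eq`; `hadm_I`,
`hAmp_I`, `hϱ : 2 ≤ 2`, `hϱA`.  NO closure ∕ anchor ∕ transfer ∕ link ∕ inner-count ∕ selector argument is passed — S51 has none.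
Conclusion LITERAL (the crew's coarse-torus currency at `A₁ = A∕4`, `r₁ = 0`). [folklore] -/
theorem componentInnerNestedToriEnd_fires (hL : 3 ≤ L) (k : ℕ) :
    ‖locE (TTouch (d := 4) (N := N')) (fun Z : (tsys 4 N').Dom => Z.1) (actI L N' r hr k 1) (X₀ N').1 -
        locE (TTouch (d := 4) (N := N')) (fun Z : (tsys 4 N').Dom => Z.1) (actI L N' r hr k 0) (X₀ N').1‖ ≤
      4 * (Real.exp 1 * 9 * 64 * K₀ 64 8 ^ 2) * (Acst / 4) * Real.exp (-(0 * torusTreeLen (X₀ N').1)) :=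
  attachedPart_locE_le_of_coresAt_pencil_components_inner_nestedTori hL (GI L N' r hr)
    (Win := Set.univ) (ctr := ctr0) (ROp := fun _ => 1) (RHist := fun _ => 2) (R' := fun _ => 2)
    (mq := fun _ _ _ => 1) (bq := fun _ _ _ => 0) (N₀ := fun _ _ _ => 1)
    hroom0 (fun _ _ _ _ _ _ _ => one_pos)
    (fun _ _ _ _ _ _ _ => ⟨fun _ _ => aestronglyMeasurable_const, fun _ => differentiableOn_const _, fun _ _ _ => by
      show ‖(1 : ℂ)‖ ≤ 1; rw [norm_one]⟩)
    (fun _ _ _ _ _ _ _ => ⟨fun _ _ => (Complex.measurable_ofReal.comp (measurable_snd.norm.pow_const 2)).aestronglyMeasurable,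
      fun _ _ => differentiableOn_const _, fun _ _ _ v => by
        show 1 * ‖v‖ ^ 2 - 0 ≤ (((‖v‖ ^ 2 : ℝ) : ℂ)).re; rw [Complex.ofReal_re]; simp⟩)
    (g := fun _ => 0) (Set.mem_univ _) (U := ()) (o := 0) (h₀ := 0) (w := liveTable) (ϱ := 2)
    (by show ‖(0 : ℂ) - 0‖ ≤ 1; simp)
    (by show ‖(0 : B13HistM toyFrame) - 0‖ + 2 * ‖liveTable‖ ≤ 2; rw [sub_zero, norm_zero, zero_add];
        linarith [norm_liveTable_le])
    (emb := fun _ => k) (fun _ => rfl) (terms := termsI L N') (act := actI L N' r hr k) (fun _ _ _ => rfl)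
    (A₀ := 0) (A₁ := Acst / 4) (r₁ := 0) (X₀ N')
    le_rfl (by have := Acst_pos; positivity) le_rfl hrate_torus_num hsmall_N
    (fun _ => (∅ : Finset Unit)) (δ := 1) (κ := rN) (α₆ := α₆F) (Rk := R₀N L) (b₀ := 0) (s := 0) (t := 0)
    α₆F_pos.le (hκk_I) h229k_I le_rfl zero_le_one le_rfl (fun W => by simp)
    (ε := εI L) (r := rN) (R := RN) (v := vN) (εI_pos L).le vN_pos.le
    (hκR_I L hL) (hrate2_I L hL) hκ_N_eq.le (h229_I L) hRR_N_eq.le (hadm_I L N' hL) (hAmp_I L N' r hr k) le_rfl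
    (by have := Acst_pos; linarith)

open Classical in
/-- … in CLOSED FORM: `≤ 4·(e·9·64·K₀(64,8)²)·(A∕4) = K₀(64,8)`. [folklore] -/
theorem componentInnerNestedToriEnd_fires_closed (hL : 3 ≤ L) (k : ℕ) :
    ‖locE (TTouch (d := 4) (N := N')) (fun Z : (tsys 4 N').Dom => Z.1) (actI L N' r hr k 1) (X₀ N').1 -
        locE (TTouch (d := 4) (N := N')) (fun Z : (tsys 4 N').Dom => Z.1) (actI L N' r hr k 0) (X₀ N').1‖ ≤ K₀ 64 8 := by
  refine (componentInnerNestedToriEnd_fires L N' r hr hL k).trans (le_of_eq ?_)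
  rw [zero_mul, neg_zero, Real.exp_zero, mul_one]
  unfold Acst
  have hK := K₀_pos (64 : ℝ) 8
  have he := Real.exp_pos 1
  field_simp

/-! ## §5 LIVE: the bounded quantity is NOT zero on the same datum -/

open Classical in
/-- **THE ACTIVITY AT `X₀` IN CLOSED FORM**: `act k s X₀ = (cM r∕2)·(εN·α₆F + v)·∫ e^{s·r·e^{−(v 0)²}}·e^{−‖v‖²} dv`. [folklore] -/
theorem actI_X₀ (k : ℕ) (s : ℂ) :
    actI L N' r hr k s (X₀ N') = ((cM r / 2 * (εN L * α₆F + vN) : ℝ) : ℂ) *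
      ∫ v : E1, cexp (s * ((r : ℂ) * (Real.exp (-(crd v ^ 2)) : ℂ))) * cexp (-(((‖v‖ ^ 2 : ℝ) : ℂ))) := by
  unfold actI
  simp only [GI_apply, termAt_coreW_pencil]
  rw [← Finset.sum_mul, ← majI_sum_X₀ L N', Finset.mul_sum]
  push_cast
  unfold cI
  push_cast
  rfl

/-- The increment between a REAL source `t` and `0` at `X₀` (W41 `closedForm_real_sub_zero`). [folklore] -/
theorem actI_real_sub_zero (k : ℕ) (t : ℝ) :
    actI L N' r hr k (t : ℂ) (X₀ N') - actI L N' r hr k 0 (X₀ N') =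
      ((cM r / 2 * (εN L * α₆F + vN) : ℝ) : ℂ) * ((∫ v, incr (t * r) v : ℝ) : ℂ) := by
  rw [actI_X₀, actI_X₀]
  exact closedForm_real_sub_zero _ r hr t

/-- **THE ATTACHED PART OF THE ACTIVITY IS NOT ZERO** (`(cM r∕2)(εN·α₆F + v) > 0`, W33's `∫ incr r > 0` for `0 < r`). [folklore] -/
theorem actI_live (hr0 : 0 < r) (k : ℕ) : actI L N' r hr k 1 (X₀ N') ≠ actI L N' r hr k 0 (X₀ N') := by
  intro h
  have h0 := sub_eq_zero.2 h
  rw [show (1 : ℂ) = ((1 : ℝ) : ℂ) from Complex.ofReal_one.symm, actI_real_sub_zero, one_mul] at h0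
  have hc : 0 < cM r / 2 * (εN L * α₆F + vN) :=
    mul_pos (half_pos (cM_pos r)) (by have := mul_pos (εN_pos L) α₆F_pos; linarith [vN_pos])
  rcases mul_eq_zero.1 h0 with hc0 | hI
  · exact hc.ne' (by exact_mod_cast hc0)
  · exact (integral_incr_pos r hr0).ne' (by exact_mod_cast hI)

/-- The activities at `X₀` lie STRICTLY inside the unit disc for `‖s‖ ≤ 2` (`εN·α₆F + v ≤ 65∕64`, W41 `norm_term_le`, `A ≤ 1`,
`√π∕√(2π) < 1`). [folklore] -/
theorem norm_actI_X₀_lt_one (k : ℕ) {s : ℂ} (hs : ‖s‖ ≤ 2) : ‖actI L N' r hr k s (X₀ N')‖ < 1 := by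
  rw [actI_X₀]
  have hp0 : 0 ≤ εN L * α₆F + vN := by have := mul_pos (εN_pos L) α₆F_pos; linarith [vN_pos]
  have hp1 := mass_le L
  have hπ : 0 < Real.sqrt Real.pi := Real.sqrt_pos.2 Real.pi_pos
  have hlt : Real.sqrt Real.pi < Real.sqrt (2 * Real.pi) := Real.sqrt_lt_sqrt Real.pi_pos.le (by linarith [Real.pi_pos])
  have hq : Real.sqrt Real.pi / Real.sqrt (2 * Real.pi) < 1 := (div_lt_one (hπ.trans hlt)).2 hlt
  have hq0 : 0 ≤ Real.sqrt Real.pi / Real.sqrt (2 * Real.pi) := by positivity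
  have hA : Acst ≤ 1 := dressedConst_le_one
  have hb := norm_term_le r hr hs
  have hn : ‖((cM r / 2 * (εN L * α₆F + vN) : ℝ) : ℂ) * ∫ v : E1, cexp (s * ((r : ℂ) * (Real.exp (-(crd v ^ 2)) : ℂ))) *
        cexp (-(((‖v‖ ^ 2 : ℝ) : ℂ)))‖ =
      (εN L * α₆F + vN) * ‖((cM r / 2 : ℝ) : ℂ) * ∫ v : E1, cexp (s * ((r : ℂ) * (Real.exp (-(crd v ^ 2)) : ℂ))) *
        cexp (-(((‖v‖ ^ 2 : ℝ) : ℂ)))‖ := by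
    rw [norm_mul, norm_mul, Complex.norm_real, Complex.norm_real, Real.norm_eq_abs, Real.norm_eq_abs, abs_mul, abs_of_nonneg hp0]
    ring
  rw [hn]
  calc (εN L * α₆F + vN) * ‖((cM r / 2 : ℝ) : ℂ) * ∫ v : E1, cexp (s * ((r : ℂ) * (Real.exp (-(crd v ^ 2)) : ℂ))) *
          cexp (-(((‖v‖ ^ 2 : ℝ) : ℂ)))‖
      ≤ (1 + 1 / 64) * (Acst / 2 * (Real.sqrt Real.pi / Real.sqrt (2 * Real.pi))) := mul_le_mul hp1 hb (norm_nonneg _) (by norm_num)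
    _ < 1 := by
        have := Acst_pos
        nlinarith

open Classical in
/-- **THE END's BOUNDED QUANTITY IS NOT ZERO** [decided toy]: equal dressed outputs on the coarse unit block would give equal activities at
`X₀` (W24's `exp_locE_cube` BY NAME), contradicting `actI_live`. [folklore] -/
theorem componentInnerNestedToriEnd_live (hr0 : 0 < r) (k : ℕ) :
    locE (TTouch (d := 4) (N := N')) (fun Z : (tsys 4 N').Dom => Z.1) (actI L N' r hr k 1) (X₀ N').1 ≠
      locE (TTouch (d := 4) (N := N')) (fun Z : (tsys 4 N').Dom => Z.1) (actI L N' r hr k 0) (X₀ N').1 := by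
  intro h
  have h1 := exp_locE_cube N' (w := actI L N' r hr k 1) (norm_actI_X₀_lt_one L N' r hr k (by simp))
  have h0 := exp_locE_cube N' (w := actI L N' r hr k 0) (norm_actI_X₀_lt_one L N' r hr k (by simp))
  have h' : cexp (locE (TTouch (d := 4) (N := N')) (fun Z : (tsys 4 N').Dom => Z.1) (actI L N' r hr k 1) {0}) =
      cexp (locE (TTouch (d := 4) (N := N')) (fun Z : (tsys 4 N').Dom => Z.1) (actI L N' r hr k 0) {0}) := congrArg cexp h
  rw [h1, h0, add_right_inj] at h'
  exact actI_live L N' r hr hr0 k h'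

open Classical in
/-- **S51's END FIRES ON A LIVE TWO-SCALE DATUM WITH N0u's LABEL** at pv22's least blocking factor `L = 3` (ℓ = 3∕7): liveness ∧ bound
on every coarse torus `N′` (print's «L an odd positive integer > 11», [Balaban1987RGI] p. 251, is TYPE only — any `3 ≤ L` works). [folklore] -/
example (hr0 : 0 < r) (k : ℕ) :
    locE (TTouch (d := 4) (N := N')) (fun Z : (tsys 4 N').Dom => Z.1) (actI 3 N' r hr k 1) (X₀ N').1 ≠
        locE (TTouch (d := 4) (N := N')) (fun Z : (tsys 4 N').Dom => Z.1) (actI 3 N' r hr k 0) (X₀ N').1 ∧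
      ‖locE (TTouch (d := 4) (N := N')) (fun Z : (tsys 4 N').Dom => Z.1) (actI 3 N' r hr k 1) (X₀ N').1 -
          locE (TTouch (d := 4) (N := N')) (fun Z : (tsys 4 N').Dom => Z.1) (actI 3 N' r hr k 0) (X₀ N').1‖ ≤ K₀ 64 8 :=
  ⟨componentInnerNestedToriEnd_live 3 N' r hr hr0 k, componentInnerNestedToriEnd_fires_closed 3 N' r hr (by norm_num) k⟩

end Summit.QuantumFields.BalabanUV.T4Continuum.NE1p.DressedSmallFieldComponentInnerNestedToriWitness

end
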